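import Summits.QuantumFields.YangMills.Theorems.BalabanLadderNTCeilingPricePackage
import Summits.QuantumFields.YangMills.Theorems.BalabanLadderNTReferenceMarginsExplicit
import Summits.QuantumFields.YangMills.Theorems.LangevinControlUVOSLegsAtWeakCouplingCStubDensity
import HarnessLib

/-!
# Crux `NT` (stmt-QuantumFields-19353), stub `stub_refpkgT : RefPkgT`: CANONICAL ENVELOPES — the lattice ℓ¹-sums of a
# witness are Riemann sums, `a⁴ Σ_{x ∈ box} |v(a x)| → ‖v‖₁`; canonical cap `ε ≤ 4C₁²‖v‖₁²/δ⁸` and canonical margin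
# `2C₁²‖v‖₁²/κ⁸`

Helper file (`--supports stmt-QuantumFields-19353`) of the fleet lead prover of crux `NT` (unit `ym-spine-19353-p1`,
GEN 12); hypothesis-free, general compact `G`, any `r`.  g11 located the next step «Riemann-sum convergence
`a⁴Σ|v(ax)| → ‖v‖₁` to make the margin numbers canonical» (SIZING-19353-g11 §4); this file does it with the tree's
`Sketch.tendsto_riemann_sum` (dominated convergence of the cell step functions), transported from `(ℝ⁴)¹`-indexed
sequences to the crux's real coupling parameter `β → ∞` and to boxes that merely COVER the support (no `a·L → ∞` needed).

* `mem_box_of_apply_ne_zero`, `sum_box_eq_sum_box_of_cover` — charged points of a witness supported in the ball of radius `ρ`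
  lie in `box L` once `ρ ≤ s·L`; larger boxes do not change the lattice sum;
* `tendsto_latticeSum_seq`, **`tendsto_latticeSum`** — for `φ` continuous with `tsupport φ ⊆ closedBall 0 ρ`, `a > 0`,
  `a → 0` (along `ℕ`, resp. along `atTop : Filter ℝ`) and eventually `ρ ≤ a·L`: **`a⁴ Σ_{x ∈ box L} φ(a x) → ∫ φ`**;
* `tendsto_envelope`, `tendsto_envelope_thetaTest`, `integral_abs_thetaTest` — for a Schwartz witness `v` supported in the
  ball of radius `σ`: `a⁴ Σ_{box L}|v(a x)| → ‖v‖₁ := ∫|v|` and `a⁴ Σ_{box L}|θv(a x)| → ∫|θv| = ‖v‖₁`;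
* **`marginKK_tendsto_canonical`** — the `k·k'` part of the registered clause-4 margin converges:
  `2(C₁(a/κ)⁴S_θ)(C₁(a/κ)⁴S_v) → 2C₁²‖v‖₁²/κ⁸` along any reference tori covering the support;
* **`floor₂_le_canonical`** — clause 1 (E1-osc, `C₁`) + a plain clause-(i) floor (the `LowerBounds` shape) ⇒
  **`ε ≤ 4C₁²‖v‖₁²/δ⁸`** (`δ` the time gap of `v`, `2δ ≤ ℓ`) — the canonical form of `floor₂_le_of_e1osc` (there with the
  sup-norm envelopes `K = M(2σ+3)⁴` of `…NTReferenceMarginsExplicit`; here with the witness's own `L¹` norm).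

NUMBERS.  For a bump `v` of height `M` on a ball of radius `ϱ` the envelope drops from `M(2σ+3)⁴` to `‖v‖₁ ≤ Mπ²ϱ⁴/2`; the
clause-4 `k·k'` margin IS `2C₁²‖v‖₁²/κ⁸ + o(1)` and the clause-1 cap IS `4C₁²‖v‖₁²/δ⁸ + o(1)`: their ratio `(δ/κ)⁸/2` is
the collar law of `…NTCeilingPricePackage`, free of every envelope.

HONEST FRAMING.  Real analysis (Riemann sums) and bookkeeping; the cap is CONDITIONAL on clause 1; no floor, not AF, not
NT, not the seam, not the gap; not Clay.  Refs: GlimmJaffe1987 §6.1 (lattice approximation, Riemann sums);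
`…LangevinControlUVOSLegsAtWeakCouplingCStubDensity` (`tendsto_riemann_sum`).
-/

set_option autoImplicit false

noncomputable section

open scoped SchwartzMap
open MeasureTheory Filter Topology
open Literature.MathematicalPhysics.QuantumFieldTheory Literature.MathematicalPhysics.QuantumLattice
open Literature.Probability.LatticeModels
open Summit.QuantumFields.YangMills.Cruxes.OSLegsFromFemtoAndGap.DlrCollarTransfer
open Summit.QuantumFields.YangMills.Theorems.OSLegsFromFemtoAndGap (mul_norm_le_norm_smul_siteToE)
open Summit.QuantumFields.YangMills.Cruxes.OSLegsAtWeakCouplingC.Sketch (tendsto_riemann_sum)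
open Summit.QuantumFields.YangMills.Cruxes.NT.Reference (tsupport_thetaTest_subset_closedBall_zero)

namespace Summit.QuantumFields.YangMills.Cruxes.NT.CeilingPrice

/-! ## §1 Lattice sums over covering boxes are Riemann sums -/

section Riemann

/-- A lattice point charged by a function supported in the ball of radius `ρ` (spacing `s > 0`) lies in every box with
`ρ ≤ s·L`. [folklore] -/
theorem mem_box_of_apply_ne_zero {φ : EuclideanSpace ℝ (Fin 4) → ℝ} {ρ s : ℝ} (hs : 0 < s)
    (hφ : tsupport φ ⊆ Metric.closedBall 0 ρ) {L : ℕ} (hL : ρ ≤ s * L) {x : Fin 4 → ℤ}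
    (hx : φ (s • siteToE x) ≠ 0) : x ∈ box 4 L := by
  have h1 : s * ‖x‖ ≤ ‖s • siteToE x‖ := mul_norm_le_norm_smul_siteToE hs.le x
  have h2 : ‖s • siteToE x‖ ≤ ρ := by
    have hmem := hφ (subset_tsupport _ (Function.mem_support.2 hx))
    rwa [Metric.mem_closedBall, dist_zero_right] at hmem
  have h3 : ‖x‖ ≤ L := le_of_mul_le_mul_left (by linarith) hs
  refine mem_box.2 fun j => ?_
  have h4 : (‖x j‖ : ℝ) ≤ ‖x‖ := norm_le_pi_norm x j
  rw [Int.norm_eq_abs] at h4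
  have h5 := abs_le.1 (h4.trans h3)
  exact ⟨by exact_mod_cast h5.1, by exact_mod_cast h5.2⟩

/-- **Larger boxes do not change the lattice sum** of a function supported in the ball of radius `ρ ≤ s·L`. [folklore] -/
theorem sum_box_eq_sum_box_of_cover {φ : EuclideanSpace ℝ (Fin 4) → ℝ} {ρ s : ℝ} (hs : 0 < s)
    (hφ : tsupport φ ⊆ Metric.closedBall 0 ρ) {L L' : ℕ} (hL : ρ ≤ s * L) (hLL' : L ≤ L') :
    ∑ x ∈ box 4 L', φ (s • siteToE x) = ∑ x ∈ box 4 L, φ (s • siteToE x) := by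
  symm
  refine Finset.sum_subset (fun x hx => ?_) (fun x _ hx => ?_)
  · rw [mem_box] at hx ⊢
    intro j
    have := hx j
    constructor <;> [linarith [this.1, (Nat.cast_le (α := ℤ)).2 hLL']; linarith [this.2, (Nat.cast_le (α := ℤ)).2 hLL']]
  · by_contra hne
    exact hx (mem_box_of_apply_ne_zero hs hφ hL hne)

/-- **Riemann sums along a sequence of spacings, boxes covering the support.**  For `φ` continuous with
`tsupport φ ⊆ closedBall 0 ρ`, spacings `a_k > 0`, `a_k → 0` and boxes with `ρ ≤ a_k L_k` eventually:
`a_k⁴ Σ_{x ∈ box L_k} φ(a_k x) → ∫ φ` (the tree's `tendsto_riemann_sum` on `(ℝ⁴)¹` after enlarging the boxes so that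
`a_k L'_k → ∞`, which does not change the sums). [cite: GlimmJaffe1987, §6.1] -/
theorem tendsto_latticeSum_seq {φ : EuclideanSpace ℝ (Fin 4) → ℝ} (hφc : Continuous φ) {ρ : ℝ}
    (hφ : tsupport φ ⊆ Metric.closedBall 0 ρ) (a : ℕ → ℝ) (L : ℕ → ℕ) (ha : ∀ k, 0 < a k)
    (ha0 : Tendsto a atTop (𝓝 0)) (hL : ∀ᶠ k in atTop, ρ ≤ a k * L k) :
    Tendsto (fun k => a k ^ 4 * ∑ x ∈ box 4 (L k), φ (a k • siteToE x)) atTop (𝓝 (∫ y, φ y)) := by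
  classical
  -- compact support, and the transported function on `(ℝ⁴)¹`
  have hφK : HasCompactSupport φ :=
    (isCompact_closedBall (0 : EuclideanSpace ℝ (Fin 4)) ρ).of_isClosed_subset (isClosed_tsupport _) hφ
  set g : (Fin 1 → EuclideanSpace ℝ (Fin 4)) → ℝ := φ ∘ (Homeomorph.funUnique (Fin 1) (EuclideanSpace ℝ (Fin 4)))
    with hg_def
  have hgc : Continuous g := hφc.comp (Homeomorph.funUnique (Fin 1) (EuclideanSpace ℝ (Fin 4))).continuous
  have hgK : HasCompactSupport g := hφK.comp_homeomorph _
  -- enlarged boxes with `a_k L'_k → ∞`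
  set L' : ℕ → ℕ := fun k => L k + ⌈(k : ℝ) / a k⌉₊ with hL'_def
  have haL' : Tendsto (fun k => a k * L' k) atTop atTop := by
    refine tendsto_atTop_mono (fun k => ?_) tendsto_natCast_atTop_atTop
    have h1 : (k : ℝ) / a k ≤ ⌈(k : ℝ) / a k⌉₊ := Nat.le_ceil _
    have h2 : (⌈(k : ℝ) / a k⌉₊ : ℝ) ≤ (L' k : ℝ) := by
      rw [hL'_def]; push_cast; linarith [Nat.cast_nonneg (α := ℝ) (L k)]
    calc (k : ℝ) = a k * ((k : ℝ) / a k) := by field_simp [(ha k).ne']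
      _ ≤ a k * L' k := by
          have := h1.trans h2
          exact mul_le_mul_of_nonneg_left this (ha k).le
  have key := tendsto_riemann_sum g hgc hgK a L' ha ha0 haL'
  -- the sums over `(box L'_k)¹` are the box sums
  have hsum : ∀ (b : ℝ) (B : Finset (Fin 4 → ℤ)),
      ∑ x ∈ Fintype.piFinset (fun _ : Fin 1 => B), g (fun i => b • siteToE (x i)) = ∑ z ∈ B, φ (b • siteToE z) := by
    intro b B
    refine Finset.sum_equiv (Equiv.funUnique (Fin 1) (Fin 4 → ℤ)) (fun x => ?_) (fun x _ => ?_)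
    · simp [Fintype.mem_piFinset, Fin.forall_fin_one]
    · rfl
  -- the integral over `(ℝ⁴)¹` is the integral over `ℝ⁴`
  have hint : ∫ y, g y = ∫ z, φ z :=
    (volume_preserving_funUnique (Fin 1) (EuclideanSpace ℝ (Fin 4))).integral_comp' φ
  simp_rw [hsum, mul_one, hint] at key
  -- the enlarged boxes carry the same sums, eventually
  refine key.congr' ?_
  filter_upwards [hL] with k hk
  rw [sum_box_eq_sum_box_of_cover (ha k) hφ hk (Nat.le_add_right _ _)]

/-- **Riemann sums along the coupling.**  For `φ` continuous with `tsupport φ ⊆ closedBall 0 ρ`, a unit map `a > 0` with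
`a → 0` along `atTop : Filter ℝ`, and boxes `L β` with `ρ ≤ a β · L β` eventually:
**`a(β)⁴ Σ_{x ∈ box (L β)} φ(a(β) x) → ∫ φ`**. [cite: GlimmJaffe1987, §6.1] -/
theorem tendsto_latticeSum {φ : EuclideanSpace ℝ (Fin 4) → ℝ} (hφc : Continuous φ) {ρ : ℝ}
    (hφ : tsupport φ ⊆ Metric.closedBall 0 ρ) (a : ℝ → ℝ) (L : ℝ → ℕ) (ha : ∀ β, 0 < a β)
    (ha0 : Tendsto a atTop (𝓝 0)) (hL : ∀ᶠ β in atTop, ρ ≤ a β * L β) :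
    Tendsto (fun β => a β ^ 4 * ∑ x ∈ box 4 (L β), φ (a β • siteToE x)) atTop (𝓝 (∫ y, φ y)) := by
  rw [tendsto_iff_seq_tendsto]
  intro u hu
  exact tendsto_latticeSum_seq hφc hφ (a ∘ u) (L ∘ u) (fun k => ha _) (ha0.comp hu) (hu.eventually hL)

end Riemann

/-! ## §2 The ℓ¹-envelopes of a Schwartz witness converge to its `L¹` norm -/

section Witness

/-- The absolute value of a witness supported in the ball of radius `σ` is supported there. [folklore] -/
theorem tsupport_abs_subset {v : EuclideanSpace ℝ (Fin 4) → ℝ} {σ : ℝ} (hvσ : tsupport v ⊆ Metric.closedBall 0 σ) :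
    tsupport (fun y => |v y|) ⊆ Metric.closedBall 0 σ := by
  refine (closure_minimal (fun y hy => ?_) Metric.isClosed_closedBall)
  have hy' : v y ≠ 0 := fun h0 => hy (by simp [h0])
  exact hvσ (subset_tsupport _ (Function.mem_support.2 hy'))

/-- **`a⁴ Σ_{x ∈ box L} |v(a x)| → ‖v‖₁`** for a Schwartz witness supported in the ball of radius `σ`, along any unit map
`a > 0`, `a → 0` and boxes with `σ ≤ a·L` eventually. [folklore] -/
theorem tendsto_envelope (v : 𝓢(EuclideanSpace ℝ (Fin 4), ℝ)) {σ : ℝ}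
    (hvσ : tsupport (v : EuclideanSpace ℝ (Fin 4) → ℝ) ⊆ Metric.closedBall 0 σ) (a : ℝ → ℝ) (L : ℝ → ℕ)
    (ha : ∀ β, 0 < a β) (ha0 : Tendsto a atTop (𝓝 0)) (hL : ∀ᶠ β in atTop, σ ≤ a β * L β) :
    Tendsto (fun β => a β ^ 4 * ∑ x ∈ box 4 (L β), |v (a β • siteToE x)|) atTop (𝓝 (∫ y, |v y|)) :=
  tendsto_latticeSum (φ := fun y => |v y|) (v.continuous.abs) (tsupport_abs_subset hvσ) a L ha ha0 hL

/-- `‖θv‖₁ = ‖v‖₁`: time reflection preserves Lebesgue measure. [folklore] -/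
theorem integral_abs_thetaTest (v : 𝓢(EuclideanSpace ℝ (Fin 4), ℝ)) :
    ∫ y, |thetaTest 4 v y| = ∫ y, |v y| := by
  simp_rw [thetaTest_apply]
  exact (timeReflection 4).measurePreserving.integral_comp (timeReflection 4).toHomeomorph.measurableEmbedding
    (fun y => |v y|)

/-- **`a⁴ Σ_{x ∈ box L} |θv(a x)| → ‖v‖₁`** likewise for the reflected witness. [folklore] -/
theorem tendsto_envelope_thetaTest (v : 𝓢(EuclideanSpace ℝ (Fin 4), ℝ)) {σ : ℝ}
    (hvσ : tsupport (v : EuclideanSpace ℝ (Fin 4) → ℝ) ⊆ Metric.closedBall 0 σ) (a : ℝ → ℝ) (L : ℝ → ℕ)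
    (ha : ∀ β, 0 < a β) (ha0 : Tendsto a atTop (𝓝 0)) (hL : ∀ᶠ β in atTop, σ ≤ a β * L β) :
    Tendsto (fun β => a β ^ 4 * ∑ x ∈ box 4 (L β), |thetaTest 4 v (a β • siteToE x)|) atTop (𝓝 (∫ y, |v y|)) := by
  rw [← integral_abs_thetaTest]
  exact tendsto_envelope (thetaTest 4 v) (tsupport_thetaTest_subset_closedBall_zero hvσ) a L ha ha0 hL

/-- **The `k·k'` part of the registered clause-4 margin is canonically `2C₁²‖v‖₁²/κ⁸`**: along any unit map `a > 0`,
`a → 0` and reference tori `L β` covering the support (`σ ≤ a β·L β` eventually),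
`2·(C₁(a/κ)⁴Σ|θv(a x)|)·(C₁(a/κ)⁴Σ|v(a y)|) → 2C₁²‖v‖₁²/κ⁸`. [folklore] -/
theorem marginKK_tendsto_canonical (v : 𝓢(EuclideanSpace ℝ (Fin 4), ℝ)) {σ : ℝ}
    (hvσ : tsupport (v : EuclideanSpace ℝ (Fin 4) → ℝ) ⊆ Metric.closedBall 0 σ) (a : ℝ → ℝ) (L : ℝ → ℕ)
    (ha : ∀ β, 0 < a β) (ha0 : Tendsto a atTop (𝓝 0)) (hL : ∀ᶠ β in atTop, σ ≤ a β * L β) (C₁ κ : ℝ) :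
    Tendsto (fun β => 2 * (C₁ * (a β / κ) ^ 4 * ∑ x ∈ box 4 (L β), |thetaTest 4 v (a β • siteToE x)|) *
        (C₁ * (a β / κ) ^ 4 * ∑ y ∈ box 4 (L β), |v (a β • siteToE y)|)) atTop
      (𝓝 (2 * C₁ ^ 2 * (∫ y, |v y|) ^ 2 / κ ^ 8)) := by
  have h1 := tendsto_envelope_thetaTest v hvσ a L ha ha0 hL
  have h2 := tendsto_envelope v hvσ a L ha ha0 hL
  have h3 := ((h1.const_mul (C₁ / κ ^ 4)).mul (h2.const_mul (C₁ / κ ^ 4))).const_mul 2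
  have e : 2 * ((C₁ / κ ^ 4 * ∫ y, |v y|) * (C₁ / κ ^ 4 * ∫ y, |v y|)) = 2 * C₁ ^ 2 * (∫ y, |v y|) ^ 2 / κ ^ 8 := by
    ring
  rw [e] at h3
  refine h3.congr fun β => ?_
  ring

end Witness

/-! ## §3 The canonical cap -/

section Cap

variable (G : Type) [Group G] [TopologicalSpace G] [IsTopologicalGroup G] [CompactSpace G]
  [MeasurableSpace G] [BorelSpace G] (r : LatticeRep G)

/-- Cap algebra: `S_θS_v(2C₁/R⁴)² = (s⁴S_θ)(s⁴S_v)·(4C₁²/(sR)⁸)`. [folklore] -/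
theorem cap₂_eq_canonical {Sθ Sv C₁ s R : ℝ} (hs : s ≠ 0) (hR : R ≠ 0) :
    Sθ * Sv * (2 * C₁ / R ^ 4) ^ 2 = (s ^ 4 * Sθ) * (s ^ 4 * Sv) * (4 * C₁ ^ 2 / (s * R) ^ 8) := by
  field_simp
  ring

/-- **The canonical price of the two-point floor: `ε ≤ 4C₁²‖v‖₁²/δ⁸`.**  Let `a > 0`, `a → 0`; assume clause 1 of the
registered package (E1-osc with `C₁ ≥ 0`, range `ℓ`, eventually in `β`) and a plain clause-(i) floor
`ε ≤ Q2_{β,L,aβ}(θv, v)` (`β ≥ β₅`, all tori with `Λ₅ ≤ aβ·L`) for a witness `v` with time gap `δ > 0`, `2δ ≤ ℓ`, support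
in the ball of radius `σ`.  Then `ε ≤ 4C₁²(∫|v|)²/δ⁸`. [folklore] -/
theorem floor₂_le_canonical (a : ℝ → ℝ) (ha : ∀ β, 0 < a β) (ha0 : Tendsto a atTop (𝓝 0)) {C₁ ℓ : ℝ} (hC₁ : 0 ≤ C₁)
    (hE1 : ∃ β₁ : ℝ, ∀ β : ℝ, β₁ ≤ β → ∀ (c : Fin 4 → ℤ) (b : ℕ), (b : ℝ) * a β ≤ ℓ →
      ∀ (η η' : LGConfig 4 G) (x : Fin 4 → ℤ), 1 ≤ depth c b x →
        |kerE G r β c b η (dens G r x) - kerE G r β c b η' (dens G r x)| ≤ C₁ / (depth c b x : ℝ) ^ 4)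
    {v : 𝓢(EuclideanSpace ℝ (Fin 4), ℝ)} {δ σ : ℝ} (hδ : 0 < δ) (hδℓ : 2 * δ ≤ ℓ)
    (hvδ : ∀ y : EuclideanSpace ℝ (Fin 4), v y ≠ 0 → δ ≤ y 0)
    (hvσ : tsupport (v : EuclideanSpace ℝ (Fin 4) → ℝ) ⊆ Metric.closedBall 0 σ) {ε β₅ Λ₅ : ℝ}
    (hfloor : ∀ β : ℝ, β₅ ≤ β → ∀ L : ℕ, Λ₅ ≤ a β * L → ε ≤ Q2 G r β L (a β) (thetaTest 4 v) v) :
    ε ≤ 4 * C₁ ^ 2 * (∫ y, |v y|) ^ 2 / δ ^ 8 := by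
  obtain ⟨β₁, H1⟩ := hE1
  -- the reference tori: carry the floor, the bulk condition and the collar of radius `⌊δ/aβ⌋₊ − 2`
  set Lf : ℝ → ℕ := fun β => ⌈Λ₅ / a β⌉₊ + ⌈2 * σ / a β⌉₊ + (4 * (⌊δ / a β⌋₊ - 2) + 8) with hLf_def
  have hLσ2 : ∀ β, 2 * σ ≤ a β * Lf β := fun β => by
    have hs := ha β
    have h1 : 2 * σ / a β ≤ ⌈2 * σ / a β⌉₊ := Nat.le_ceil _
    have h2 : (⌈2 * σ / a β⌉₊ : ℝ) ≤ Lf β := by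
      rw [hLf_def]; push_cast
      linarith [Nat.cast_nonneg (α := ℝ) ⌈Λ₅ / a β⌉₊, Nat.cast_nonneg (α := ℝ) (⌊δ / a β⌋₊ - 2)]
    calc 2 * σ = a β * (2 * σ / a β) := by field_simp
      _ ≤ a β * Lf β := by nlinarith
  have hLΛ : ∀ β, Λ₅ ≤ a β * Lf β := fun β => by
    have hs := ha β
    have h1 : Λ₅ / a β ≤ ⌈Λ₅ / a β⌉₊ := Nat.le_ceil _
    have h2 : (⌈Λ₅ / a β⌉₊ : ℝ) ≤ Lf β := by
      rw [hLf_def]; push_cast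
      linarith [Nat.cast_nonneg (α := ℝ) ⌈2 * σ / a β⌉₊, Nat.cast_nonneg (α := ℝ) (⌊δ / a β⌋₊ - 2)]
    calc Λ₅ = a β * (Λ₅ / a β) := by field_simp
      _ ≤ a β * Lf β := by nlinarith
  have hLσ : ∀ᶠ β in atTop, σ ≤ a β * Lf β := Eventually.of_forall fun β => by
    rcases le_or_gt 0 σ with h | h
    · linarith [hLσ2 β]
    · have : 0 ≤ a β * Lf β := mul_nonneg (ha β).le (Nat.cast_nonneg _)
      linarith
  -- eventually: the cap in canonical variables
  have hev : ∀ᶠ β in atTop, ε ≤ (a β ^ 4 * ∑ x ∈ box 4 (Lf β), |thetaTest 4 v (a β • siteToE x)|) *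
      (a β ^ 4 * ∑ y ∈ box 4 (Lf β), |v (a β • siteToE y)|) * (4 * C₁ ^ 2 / (δ - 3 * a β) ^ 8) := by
    have hsmall : ∀ᶠ β in atTop, a β < δ / 3 := ha0.eventually (gt_mem_nhds (by positivity))
    filter_upwards [hsmall, eventually_ge_atTop β₁, eventually_ge_atTop β₅] with β hβs hβ1 hβ5
    have hs : 0 < a β := ha β
    have h3 : 3 * a β < δ := by linarith
    obtain ⟨hR1, hR2, hR3, hR4⟩ := collarRadius_spec hs h3
    have hRL : 4 * (⌊δ / a β⌋₊ - 2) + 8 ≤ Lf β := by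
      show 4 * (⌊δ / a β⌋₊ - 2) + 8 ≤ ⌈Λ₅ / a β⌉₊ + ⌈2 * σ / a β⌉₊ + (4 * (⌊δ / a β⌋₊ - 2) + 8)
      exact Nat.le_add_left _ _
    have hRℓ : ((2 * (⌊δ / a β⌋₊ - 2) + 3 : ℕ) : ℝ) * a β ≤ ℓ := hR3.trans (by linarith)
    have hfl := hfloor β hβ5 (Lf β) (hLΛ β)
    have hcap := abs_Q2_le_of_e1osc G r β hC₁ hs (H1 β hβ1) hvδ hvσ (hLσ2 β) hR1 hRℓ hRL hR2
    have hRpos : (0 : ℝ) < ((⌊δ / a β⌋₊ - 2 : ℕ) : ℝ) := by exact_mod_cast hR1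
    have hSθ0 : 0 ≤ a β ^ 4 * ∑ x ∈ box 4 (Lf β), |thetaTest 4 v (a β • siteToE x)| :=
      mul_nonneg (pow_nonneg hs.le 4) (Finset.sum_nonneg fun _ _ => abs_nonneg _)
    have hSv0 : 0 ≤ a β ^ 4 * ∑ y ∈ box 4 (Lf β), |v (a β • siteToE y)| :=
      mul_nonneg (pow_nonneg hs.le 4) (Finset.sum_nonneg fun _ _ => abs_nonneg _)
    have hKK : 0 ≤ 4 * C₁ ^ 2 := mul_nonneg (by norm_num) (sq_nonneg C₁)
    calc ε ≤ Q2 G r β (Lf β) (a β) (thetaTest 4 v) v := hfl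
      _ ≤ |Q2 G r β (Lf β) (a β) (thetaTest 4 v) v| := le_abs_self _
      _ ≤ _ := hcap
      _ = (a β ^ 4 * ∑ x ∈ box 4 (Lf β), |thetaTest 4 v (a β • siteToE x)|) *
            (a β ^ 4 * ∑ y ∈ box 4 (Lf β), |v (a β • siteToE y)|) *
            (4 * C₁ ^ 2 / (a β * ((⌊δ / a β⌋₊ - 2 : ℕ) : ℝ)) ^ 8) := cap₂_eq_canonical hs.ne' hRpos.ne'
      _ ≤ _ := mul_le_mul_of_nonneg_left
            (div_le_div_of_nonneg_left hKK (pow_pos (by linarith) 8) (pow_le_pow_left₀ (by linarith) hR4 8))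
            (mul_nonneg hSθ0 hSv0)
  -- the limit
  have h1 := tendsto_envelope_thetaTest v hvσ a Lf ha ha0 hLσ
  have h2 := tendsto_envelope v hvσ a Lf ha ha0 hLσ
  have h3 : Tendsto (fun β => 4 * C₁ ^ 2 / (δ - 3 * a β) ^ 8) atTop (𝓝 (4 * C₁ ^ 2 / δ ^ 8)) := by
    have h : Tendsto (fun β => (δ - 3 * a β) ^ 8) atTop (𝓝 ((δ - 3 * 0) ^ 8)) :=
      (tendsto_const_nhds.sub (ha0.const_mul 3)).pow 8
    rw [mul_zero, sub_zero] at h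
    exact tendsto_const_nhds.div h (pow_ne_zero 8 hδ.ne')
  have hlim := (h1.mul h2).mul h3
  have e : (∫ y, |v y|) * (∫ y, |v y|) * (4 * C₁ ^ 2 / δ ^ 8) = 4 * C₁ ^ 2 * (∫ y, |v y|) ^ 2 / δ ^ 8 := by ring
  rw [e] at hlim
  exact ge_of_tendsto hlim hev

end Cap

end Summit.QuantumFields.YangMills.Cruxes.NT.CeilingPrice

end
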